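import Literature.NumberTheory.EllipticCurves.PadicLogFiniteExtension
import Mathlib.RingTheory.Trace.Basic
import Mathlib.NumberTheory.Padics.PadicIntegers
import HarnessLib

/-!
# Kato's formula off the level: `⟨x, P⟩ = −Tr(c · log_ω P)` for all `P` from the same formula on the level `E⁽ᵖ⁾`

Topic `Literature/NumberTheory/PAdicHodge`; THEOREMS ONLY (no definition, no named fact, no instance, no `sorry`). Gap 2b of memo
`Cruxes/StarredOptimalManinUnitFiveSeven/Lines/kato-lever-K3-legendre.md` §4: the B₂-road proves Kato's formula
`⟨[η], P⟩ = −Tr_{F/ℚ_p}(log_ω(P) · b)` for points `P` of the level `E⁽ᵖ⁾(F)` (where integrating elements live); since the pairing is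
additive in `P` (`tatePairingPoint` is a bi-additive hom) and `log_ω(n • P) = n · log_ω(P)` (`padicLogPointFiniteExt_nsmul`), and every
point has a positive multiple in the level (`exists_nsmul_mem_level_of_finite_residueField`), the formula holds for EVERY `P` with such a
multiple (`char ℚ_p = 0`). Stated for an arbitrary additive `ℤ_p`-valued functional `f` of the point (apply with `f = ⟨x, ·⟩`).

★ `eq_neg_trace_mul_of_forall_level` — `(∀ Q ∈ E⁽ᵖ⁾, f Q = −Tr(b · log_ω Q)) ∧ m • P ∈ E⁽ᵖ⁾ (m > 0) ⟹ f P = −Tr(b · log_ω P)`.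

## References
* K. Kato, LNM 1553 (1993), Ch. II Thm. 1.4.1 (4) (the formula for all `b ∈ E(K)`). [Kato1993LNM1553]
* J. H. Silverman, *AEC* (2009), VII.2.2, IV.6.4. [SilvermanAEC2009]
-/

noncomputable section

open scoped NNReal Classical

namespace Literature.NumberTheory.PAdicHodge

open Literature.NumberTheory.EllipticCurves FormalGroupChart

variable {p : ℕ} [Fact p.Prime] {K : Type*} [Field K] [Algebra ℚ_[p] K] (w : Valuation K ℝ≥0) (V : WeierstrassCurve K)
  [V.IsIntegral w.integer]

/-- ★ **Kato's formula off the level.** Let `f : E(K) →+ ℤ_p` be additive (e.g. `P ↦ ⟨x, P⟩`), `b ∈ K`, and suppose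
`(f Q : ℚ_p) = −Tr_{K/ℚ_p}(b · log_ω Q)` for every `Q` in the level `E⁽ᵖ⁾(K)`. Then the same holds at every point `P` having a positive
multiple `m • P` in the level. [cite: Kato1993LNM1553, Ch. II Thm. 1.4.1 (4)] [cite: SilvermanAEC2009, Prop. VII.2.2, Thm. IV.6.4] -/
theorem eq_neg_trace_mul_of_forall_level (hp0 : (p : K) ≠ 0) (hp1 : w (p : K) < 1)
    (hℓ : ∀ Q ∈ level w V (w (p : K)), ∀ r : ℕ,
      w (limitLog w V p Q - ((p ^ r) • Q).zCoord / (p : K) ^ r) ≤ w (p : K) ^ (r + 1))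
    (f : V.toAffine.Point →+ ℤ_[p]) (b : K)
    (hlevel : ∀ Q ∈ level w V (w (p : K)), ((f Q : ℤ_[p]) : ℚ_[p]) = -Algebra.trace ℚ_[p] K (b * padicLogPointFiniteExt w V p Q))
    {P : V.toAffine.Point} {m : ℕ} (hm : 0 < m) (hmP : m • P ∈ level w V (w (p : K))) :
    ((f P : ℤ_[p]) : ℚ_[p]) = -Algebra.trace ℚ_[p] K (b * padicLogPointFiniteExt w V p P) := by
  have h := hlevel _ hmP
  rw [map_nsmul, padicLogPointFiniteExt_nsmul (w := w) (V := V) (p := p) hp0 hp1 hℓ hm hmP m] at h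
  have htr : Algebra.trace ℚ_[p] K (b * ((m : K) * padicLogPointFiniteExt w V p P)) =
      (m : ℚ_[p]) * Algebra.trace ℚ_[p] K (b * padicLogPointFiniteExt w V p P) := by
    rw [mul_left_comm, ← nsmul_eq_mul, LinearMap.map_smul_of_tower, nsmul_eq_mul]
  rw [htr, nsmul_eq_mul, PadicInt.coe_mul, PadicInt.coe_natCast, ← mul_neg] at h
  have hm0 : (m : ℚ_[p]) ≠ 0 := by exact_mod_cast hm.ne'
  exact mul_left_cancel₀ hm0 h

end Literature.NumberTheory.PAdicHodge

end
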